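import Literature.NumberTheory.GaloisRepresentations.UnramifiedKummer
import Literature.NumberTheory.GaloisRepresentations.WildInertia
import Literature.NumberTheory.GaloisRepresentations.TameInertiaCharacterProofs
import Literature.NumberTheory.GaloisRepresentations.WeilGroupProofs
import Mathlib.Algebra.Category.Grp.Injective
import Mathlib.GroupTheory.Abelianization.Defs
import Mathlib.GroupTheory.Index
import Mathlib.Topology.Algebra.OpenSubgroup
import HarnessLib

/-!
# Characters of the inertia group of a local field that are non-trivial on an open subgroup

Topic `Literature/NumberTheory/GaloisRepresentations`, proof file (theorems only; no definition, no
named fact), next to `WeilDeligneOfGalois` (the Grothendieck–Deligne dictionary as the relation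
`IsWeilDeligneOfLadic ρW r`) and `WeilDeligneOfGaloisUnramifiedProofs`.

Let `F` be a non-archimedean local field with inertia group `I_F = WeilGroup.inertia F ≤ W_F` and
residue characteristic `p`, and let `E` be a field of characteristic `0`.  The relation
`IsWeilDeligneOfLadic ρW r` (Deligne 1973, §8.4.2; Tate 1979, (4.2.1)) quantifies over a character
`t : I_F →* E` which is NON-TRIVIAL on an open subgroup `U ≤ I_F` on which `ρW = exp(t • N)`; the
genuine such character is the `ℓ`-adic tame character `t_ℓ : I_F ↠ ℤ_ℓ(1)` (Serre–Tate 1968,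
Appendix; it is non-trivial on every open subgroup of `I_F` because `ℤ_ℓ(1)` is torsion-free).  This
file proves that characters with this non-triviality property EXIST, for every `E` of characteristic
`0` and every open `U ≤ I_F`:

* `WeilGroup.exists_inertiaCharacter_ne_one` — there are `t : I_F →* Multiplicative E` and `u ∈ U`
  with `t u ≠ 1`.

This is exactly the input that makes the trivial-monodromy case of the dictionary
(`IsWeilDeligneOfLadic.of_N_eq_zero`) applicable: for `ρW` with finite image of inertia the pair
`(ρW, N = 0)` IS a Weil–Deligne representation attached to `ρW`.

## Proof

The tame quotient of `I_F` is `∏_{ℓ ≠ p} ℤ_ℓ(1)` (Serre 1972, §1.3, Prop. 2: the Kummer character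
`θ_d : I_F → μ_d`, `σ ↦ σ(ϖ^{1/d})/ϖ^{1/d}`, is surjective for every `d` prime to `p`).  We only use,
from the tree, the surjectivity `exists_mem_absInertia_smul_eq_mul` and the fact that inertia fixes
the roots of unity of order prime to `p` (`smul_eq_self_of_pow_eq_one_of_mem_absInertia`):

1. (`exists_kummerHom`) for `z ∈ F̄` with `z ^ d = ϖ`, `p ∤ d`, the Kummer cocycle
   `σ ↦ σ(z)/z` is a homomorphism `I_F →* F̄ˣ` (inertia fixes the values, which lie in `μ_d`).
2. (`exists_absInertia_forall_pow_ne_one`) fix a prime `ℓ ≠ p`, a uniformiser `ϖ`, an `ℓ`-th root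
   `z₁` of `ϖ`, a primitive `ℓ`-th root of unity `ζ₀` and `σ₀ ∈ I_F` with `σ₀ z₁ = ζ₀ z₁`.  For every
   `n ≥ 1` and every `ℓ^n`-th root `z` of `ϖ`, `c = σ₀(z)/z` satisfies `c ^ ℓ^n = 1` and
   `c ^ ℓ^(n-1) = σ₀(w)/w = ζ₀ ≠ 1` where `w = z ^ ℓ^(n-1)` is another `ℓ`-th root of `ϖ` (so
   `w = η z₁` with `η ∈ μ_ℓ` fixed by `σ₀`); hence `c ^ n ≠ 1` (else `c ^ gcd(n, ℓ^n) = 1` with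
   `gcd(n, ℓ^n) = ℓ^j`, `ℓ^j ≤ n < ℓ^n`, so `j ≤ n - 1` and `c ^ ℓ^(n-1) = 1`).  So the image of
   `σ₀` in the abelianisation `I_F^{ab}` has infinite order.
3. (`exists_monoidHom_multiplicative_of_not_isOfFinOrder`) for a group `G` and `g ∈ G` whose image
   in `G^{ab}` has infinite order there is `t : G →* Multiplicative E` with `t g = ofAdd 1`: the
   additive group of a field of characteristic `0` is divisible, hence an injective `ℤ`-module
   (Baer; Mathlib `Module.Baer.of_divisible`), so the character `k • ḡ ↦ k` of the infinite cyclic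
   subgroup `ℤ ḡ ≤ G^{ab}` extends to `G^{ab}`.
4. (`WeilGroup.exists_inertiaCharacter_ne_one`) `I_F` is compact (`WeilGroup.isCompact_inertia_holds`),
   so an open `U ≤ I_F` has finite index and contains `σ₀ ^ k` for some `k ≥ 1`;
   `t (σ₀ ^ k) = ofAdd k ≠ 1` in characteristic `0`.

The character produced here is not asserted to be continuous or `ℓ`-adic; the relation
`IsWeilDeligneOfLadic` asks for neither.  Discharged facts used (all proved in the tree):
`IsNonarchimedeanLocalField.exists_mem_absInertia_smul_eq_mul`,
`smul_eq_self_of_pow_eq_one_of_mem_absInertia`, `ringChar_residueField_prime`,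
`WeilGroup.isCompact_inertia_holds`, `WeilGroup.isTopologicalGroup_holds`.

## References

* J.-P. Serre, *Propriétés galoisiennes des points d'ordre fini des courbes elliptiques*, Invent.
  Math. 15 (1972), §1.3, Prop. 2. [SerreInventiones1972]
* J.-P. Serre, J. Tate, *Good reduction of abelian varieties*, Ann. of Math. 88 (1968), Appendix.
  [SerreTate1968]
* P. Deligne, *Les constantes des équations fonctionnelles des fonctions `L`*, Antwerp II, LNM 349
  (1973), §8.4.2. [DeligneAntwerpII1973]
* R. Baer, *Abelian groups that are direct summands of every containing abelian group*, Bull. AMS 46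
  (1940) (divisible groups are injective). [folklore]
-/

noncomputable section

open scoped Valued
open Field ValuativeRel

namespace Literature.NumberTheory.GaloisRepresentations

open GaloisRepresentations.IsNonarchimedeanLocalField

universe u

/-! ### 1. Abstract: characters of a group detecting an element of infinite order in `G^{ab}` -/

section Abstract

variable {G : Type*} [Group G]

/-- **Extension of characters from an infinite cyclic subgroup of the abelianisation.**  If the
image of `g` in `G^{ab}` has infinite order, then for every field `E` of characteristic `0` there is
a homomorphism `t : G →* Multiplicative E` with `t g = ofAdd 1` (in particular `t g ≠ 1`): `(E, +)`
is divisible, hence an injective `ℤ`-module (Baer's criterion, Mathlib `Module.Baer.of_divisible`),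
so `k • ḡ ↦ (k : E)` extends from `ℤ ḡ` to `G^{ab}`. [folklore] -/
theorem exists_monoidHom_multiplicative_of_not_isOfFinOrder (E : Type*) [Field E] [CharZero E]
    {g : G} (hg : ¬ IsOfFinOrder (Abelianization.of g)) :
    ∃ t : G →* Multiplicative E, t g = Multiplicative.ofAdd 1 := by
  set a : Abelianization G := Abelianization.of g with ha
  -- the injection `ℤ → Additive G^{ab}`, `k ↦ k • a`
  let f : ℤ →+ Additive (Abelianization G) := zmultiplesHom (Additive (Abelianization G)) (Additive.ofMul a)
  have hf : Function.Injective f := by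
    have h := injective_zpow_iff_not_isOfFinOrder.mpr hg
    intro m n hmn
    apply h
    have h' := congrArg Additive.toMul hmn
    simpa [f] using h'
  obtain ⟨h, hh⟩ := (Module.Baer.of_divisible E).extension_property_addMonoidHom f hf
    (Int.castAddHom E)
  refine ⟨(AddMonoidHom.toMultiplicativeRight h).comp Abelianization.of, ?_⟩
  have h1 : h (Additive.ofMul a) = 1 := by
    have := congr($hh 1)
    simpa [f] using this
  rw [MonoidHom.comp_apply, ← ha]
  change Multiplicative.ofAdd (h (Additive.ofMul a)) = _
  rw [h1]

/-- A homomorphism to a commutative group kills nothing of infinite order in `G^{ab}`: if for every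
`n ≥ 1` some homomorphism `ψ : G →* C` into a commutative group has `ψ g ^ n ≠ 1`, then the image
of `g` in `G^{ab}` has infinite order. [folklore] -/
theorem not_isOfFinOrder_abelianization_of {g : G}
    (h : ∀ n : ℕ, 0 < n → ∃ (C : Type u) (_ : CommGroup C) (ψ : G →* C), ψ g ^ n ≠ 1) :
    ¬ IsOfFinOrder (Abelianization.of g) := by
  intro hfin
  obtain ⟨n, hn, hgn⟩ := hfin.exists_pow_eq_one
  obtain ⟨C, _, ψ, hψ⟩ := h n hn
  apply hψ
  have := congrArg (Abelianization.lift ψ) hgn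
  rwa [map_pow, Abelianization.lift_apply_of, map_one] at this

end Abstract

/-! ### 2. Local fields: an inertia element of infinite order in `I_F^{ab}` (Kummer theory) -/

section Local

variable {F : Type u} [Field F] [ValuativeRel F] [TopologicalSpace F] [IsNonarchimedeanLocalField F]

/-- `Γ_F` fixes the image of `a ∈ 𝒪[F]` in `F̄` — deprecated alias of
`smul_algebraMap_valuationInteger` (`ModPGaloisRep.lean`, argument order `F a σ`), which the proofs
below use directly (librarian dedup-02650). [folklore] -/
@[deprecated smul_algebraMap_valuationInteger (since := "2026-08-17")]
alias absoluteGaloisGroup_smul_algebraMap_integer := smul_algebraMap_valuationInteger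

/-- **The Kummer cocycle is a homomorphism on inertia.**  For `z ∈ F̄` with `z ^ d = ϖ`
(`ϖ ∈ 𝒪[F]` non-zero in `F̄`, `d ≥ 1` prime to `p`), `σ ↦ σ(z)/z` is a group homomorphism
`I_F →* F̄ˣ`: its values are `d`-th roots of unity, which inertia fixes
(`smul_eq_self_of_pow_eq_one_of_mem_absInertia`), so the cocycle identity
`c(στ) = σ(c(τ)) c(σ)` reads `c(στ) = c(τ) c(σ)`. [cite: SerreInventiones1972, §1.3] -/
theorem exists_kummerHom {d : ℕ} (hd : 0 < d) (hpd : ¬ ringChar 𝓀[F] ∣ d) {ϖ : 𝒪[F]}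
    {z : AlgebraicClosure F} (hz : z ^ d = algebraMap 𝒪[F] (AlgebraicClosure F) ϖ) (hz0 : z ≠ 0) :
    ∃ ψ : absInertia F →* (AlgebraicClosure F)ˣ,
      ∀ σ : absInertia F, (ψ σ : AlgebraicClosure F) = (σ : absoluteGaloisGroup F) • z / z := by
  -- the cocycle and its values
  have hne : ∀ σ : absoluteGaloisGroup F, σ • z ≠ 0 := fun σ => by
    rw [absoluteGaloisGroup.smul_def]
    exact (map_ne_zero _).mpr hz0
  have hcd : ∀ σ : absoluteGaloisGroup F, (σ • z / z) ^ d = 1 := fun σ => by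
    rw [div_pow, ← smul_pow', hz, smul_algebraMap_valuationInteger, div_self]
    rw [← hz]
    exact pow_ne_zero _ hz0
  let c : absInertia F → (AlgebraicClosure F)ˣ := fun σ =>
    Units.mk0 ((σ : absoluteGaloisGroup F) • z / z) (div_ne_zero (hne σ) hz0)
  refine ⟨MonoidHom.mk' c fun σ τ => ?_, fun σ => rfl⟩
  ext
  simp only [c, Units.val_mul, Units.val_mk0, Subgroup.coe_mul]
  -- `(στ) z = σ (c(τ) z) = c(τ) σ(z)` since `σ ∈ I_F` fixes the root of unity `c(τ)`
  have hfix : (σ : absoluteGaloisGroup F) • ((τ : absoluteGaloisGroup F) • z / z) =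
      (τ : absoluteGaloisGroup F) • z / z :=
    smul_eq_self_of_pow_eq_one_of_mem_absInertia σ.2 hd hpd (hcd τ)
  have hτz : (τ : absoluteGaloisGroup F) • z = ((τ : absoluteGaloisGroup F) • z / z) * z := by
    rw [div_mul_cancel₀ _ hz0]
  rw [mul_smul, hτz, smul_mul', hfix]
  field_simp

/-- **An inertia element of infinite order in `I_F^{ab}`** (Serre 1972, §1.3, Prop. 2 — the tame
quotient `∏_{ℓ ≠ p} ℤ_ℓ(1)` of `I_F` is torsion-free and non-trivial — in the elementary form used
here): there is `σ₀ ∈ I_F` such that for every `n ≥ 1` some Kummer homomorphism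
`ψ : I_F →* F̄ˣ` has `ψ(σ₀) ^ n ≠ 1`.  Take a prime `ℓ ≠ p`, a uniformiser `ϖ`, `σ₀` moving an
`ℓ`-th root `z₁` of `ϖ` by a primitive `ℓ`-th root of unity `ζ₀`
(`exists_mem_absInertia_smul_eq_mul`); for the Kummer homomorphism `ψ` of an `ℓ^n`-th root `z` of
`ϖ`, `ψ(σ₀) ^ ℓ^(n-1) = ζ₀ ≠ 1` while `ψ(σ₀) ^ ℓ^n = 1`, so `ψ(σ₀) ^ n ≠ 1`.
[cite: SerreInventiones1972, §1.3 Prop. 2] -/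
theorem exists_absInertia_forall_pow_ne_one :
    ∃ σ₀ : absInertia F, ∀ n : ℕ, 0 < n →
      ∃ ψ : absInertia F →* (AlgebraicClosure F)ˣ, ψ σ₀ ^ n ≠ 1 := by
  classical
  -- a prime `ℓ` different from the residue characteristic `p`
  set p := ringChar 𝓀[F] with hp
  have hpp : p.Prime := ringChar_residueField_prime (F := F)
  obtain ⟨ℓ, hpℓ, hℓ⟩ := Nat.exists_infinite_primes (p + 1)
  have hpℓ' : ¬ p ∣ ℓ := fun h => by
    rcases (Nat.dvd_prime hℓ).mp h with h1 | h1
    · exact hpp.one_lt.ne' h1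
    · omega
  have hℓpos : 0 < ℓ := hℓ.pos
  have hpℓn : ∀ n : ℕ, ¬ p ∣ ℓ ^ n := fun n h => hpℓ' (hpp.dvd_of_dvd_pow h)
  -- a uniformiser, an `ℓ`-th root `z₁` of it, a primitive `ℓ`-th root of unity `ζ₀`
  obtain ⟨ϖ, hϖ⟩ := IsDiscreteValuationRing.exists_irreducible 𝒪[F]
  have hϖ0 : algebraMap 𝒪[F] (AlgebraicClosure F) ϖ ≠ 0 := by
    rw [IsScalarTower.algebraMap_apply 𝒪[F] F (AlgebraicClosure F), map_ne_zero,
      map_ne_zero_iff _ Subtype.val_injective]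
    exact hϖ.ne_zero
  obtain ⟨z₁, hz₁⟩ := IsAlgClosed.exists_pow_nat_eq (algebraMap 𝒪[F] (AlgebraicClosure F) ϖ) hℓpos
  have hz₁0 : z₁ ≠ 0 := by
    rintro rfl
    rw [zero_pow hℓpos.ne'] at hz₁
    exact hϖ0 hz₁.symm
  haveI : NeZero ((ℓ : ℕ) : AlgebraicClosure F) := by
    haveI := neZero_natCast_of_not_ringChar_dvd (F := F) hpℓ'
    exact NeZero.nat_of_injective (algebraMap F (AlgebraicClosure F)).injective
  obtain ⟨ζ₀, hζ₀⟩ := HasEnoughRootsOfUnity.exists_primitiveRoot (AlgebraicClosure F) ℓ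
  obtain ⟨σ₀, hσ₀I, hσ₀⟩ := exists_mem_absInertia_smul_eq_mul hℓpos hϖ hz₁ hζ₀.pow_eq_one
  refine ⟨⟨σ₀, hσ₀I⟩, fun n hn => ?_⟩
  -- level `ℓ ^ n`: an `ℓ^n`-th root `z` of `ϖ` and its Kummer homomorphism
  have hdpos : 0 < ℓ ^ n := pow_pos hℓpos n
  obtain ⟨z, hz⟩ := IsAlgClosed.exists_pow_nat_eq (algebraMap 𝒪[F] (AlgebraicClosure F) ϖ) hdpos
  have hz0 : z ≠ 0 := by
    rintro rfl
    rw [zero_pow hdpos.ne'] at hz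
    exact hϖ0 hz.symm
  obtain ⟨ψ, hψ⟩ := exists_kummerHom hdpos (hpℓn n) hz hz0
  refine ⟨ψ, fun hψn => ?_⟩
  -- `c = σ₀ z / z` has `c ^ n = 1` and `c ^ ℓ^n = 1` …
  set c : AlgebraicClosure F := σ₀ • z / z with hc
  have hcn : c ^ n = 1 := by
    have := congrArg (fun x : (AlgebraicClosure F)ˣ => (x : AlgebraicClosure F)) hψn
    simpa [hψ] using this
  have hcℓ : c ^ ℓ ^ n = 1 := by
    rw [hc, div_pow, ← smul_pow', hz, smul_algebraMap_valuationInteger, div_self hϖ0]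
  -- … but `c ^ ℓ^(n-1) = ζ₀ ≠ 1`: `w = z ^ ℓ^(n-1)` is an `ℓ`-th root of `ϖ`, `w = η z₁`, `η ∈ μ_ℓ`
  set w : AlgebraicClosure F := z ^ ℓ ^ (n - 1) with hw
  have hwℓ : w ^ ℓ = algebraMap 𝒪[F] (AlgebraicClosure F) ϖ := by
    rw [hw, ← pow_mul, ← pow_succ, Nat.sub_add_cancel hn, hz]
  set η : AlgebraicClosure F := w / z₁ with hη
  have hηℓ : η ^ ℓ = 1 := by
    rw [hη, div_pow, hwℓ, hz₁, div_self hϖ0]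
  have hwη : w = η * z₁ := by rw [hη, div_mul_cancel₀ _ hz₁0]
  have hσ₀w : σ₀ • w = ζ₀ * w := by
    rw [hwη, smul_mul', smul_eq_self_of_pow_eq_one_of_mem_absInertia hσ₀I hℓpos hpℓ' hηℓ, hσ₀]
    ring
  have hw0 : w ≠ 0 := pow_ne_zero _ hz0
  have hcpow : c ^ ℓ ^ (n - 1) = ζ₀ := by
    rw [hc, div_pow, ← smul_pow', ← hw, hσ₀w, mul_div_assoc, div_self hw0, mul_one]
  -- `gcd (n, ℓ^n) = ℓ^j` with `j ≤ n - 1`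
  have hg : c ^ Nat.gcd n (ℓ ^ n) = 1 := pow_gcd_eq_one.mpr ⟨hcn, hcℓ⟩
  obtain ⟨j, hjn, hj⟩ := (Nat.dvd_prime_pow hℓ).mp (Nat.gcd_dvd_right n (ℓ ^ n))
  have hjle : ℓ ^ j ≤ n := by
    rw [← hj]
    exact Nat.le_of_dvd hn (Nat.gcd_dvd_left n (ℓ ^ n))
  have hj' : j ≤ n - 1 := by
    by_contra hcon
    have hjn' : j = n := by omega
    rw [hjn'] at hjle
    exact absurd hjle (not_le.mpr (Nat.lt_pow_self hℓ.one_lt))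
  have h1 : c ^ ℓ ^ (n - 1) = 1 := by
    obtain ⟨k, hk⟩ := Nat.pow_dvd_pow ℓ hj'
    rw [hk, pow_mul, ← hj, hg, one_pow]
  rw [hcpow] at h1
  exact hζ₀.ne_one hℓ.one_lt h1

end Local

/-! ### 3. The Weil group: characters of `I_F` non-trivial on a given open subgroup -/

namespace WeilGroup

variable {F : Type u} [Field F] [ValuativeRel F] [TopologicalSpace F] [IsNonarchimedeanLocalField F]

/-- **Characters of inertia non-trivial on an open subgroup exist.**  For a non-archimedean local
field `F`, a field `E` of characteristic `0` and an open subgroup `U` of the Weil group `W_F`, there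
are a homomorphism `t : I_F →* Multiplicative E` and `u ∈ U ∩ I_F` with `t u ≠ 1` (the printed use
has `U ≤ I_F`) — the non-degeneracy input of the Grothendieck–Deligne relation
`IsWeilDeligneOfLadic` (the genuine `ℓ`-adic tame character `t_ℓ : I_F ↠ ℤ_ℓ(1) ⊆ ℚ̄_ℓ` of
Serre–Tate is such a `t`; here `t` is obtained from an inertia element `σ₀` of infinite order in
`I_F^{ab}` — Kummer theory, `exists_absInertia_forall_pow_ne_one` — by injectivity of the divisible
group `(E, +)`, and `σ₀ ^ k ∈ U` for some `k ≥ 1` because `U` has finite index in the compact group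
`I_F`). [cite: SerreTate1968, Appendix] [cite: DeligneAntwerpII1973, §8.4.2]
[cite: SerreInventiones1972, §1.3 Prop. 2] -/
theorem exists_inertiaCharacter_ne_one (E : Type*) [Field E] [CharZero E]
    (U : Subgroup (WeilGroup F)) (hUo : IsOpen (U : Set (WeilGroup F))) :
    ∃ t : inertia F →* Multiplicative E, ∃ u : inertia F, (u : WeilGroup F) ∈ U ∧ t u ≠ 1 := by
  classical
  obtain ⟨σ₀, hσ₀⟩ := exists_absInertia_forall_pow_ne_one (F := F)
  -- `σ₀` as an element of `I_F ≤ W_F`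
  let g₀ : WeilGroup F := WeilGroup.mk (σ₀ : absoluteGaloisGroup F)
    ⟨0, isFrobPow_zero_iff_mem_absInertia.mpr σ₀.2⟩
  have hg₀ : g₀ ∈ inertia F := by
    rw [mem_inertia_iff, WeilGroup.toAbsGalois_mk]
    exact σ₀.2
  set g : inertia F := ⟨g₀, hg₀⟩ with hgdef
  -- restriction `I_F (Weil) →* absInertia F`
  let ι : inertia F →* absInertia F := (toAbsGalois F).subgroupComap (absInertia F)
  have hιg : ι g = σ₀ := by
    apply Subtype.ext
    change toAbsGalois F g₀ = σ₀
    rw [WeilGroup.toAbsGalois_mk]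
  -- the image of `g` in `I_F^{ab}` has infinite order
  have hinf : ¬ IsOfFinOrder (Abelianization.of g) := by
    refine not_isOfFinOrder_abelianization_of fun n hn => ?_
    obtain ⟨ψ, hψ⟩ := hσ₀ n hn
    refine ⟨(AlgebraicClosure F)ˣ, inferInstance, ψ.comp ι, ?_⟩
    rwa [MonoidHom.comp_apply, hιg]
  obtain ⟨t, ht⟩ := exists_monoidHom_multiplicative_of_not_isOfFinOrder E hinf
  -- `U` has finite index in the compact group `I_F`
  haveI : IsTopologicalGroup (WeilGroup F) := isTopologicalGroup_holds F
  haveI : CompactSpace (inertia F) := isCompact_iff_compactSpace.mp (isCompact_inertia_holds F)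
  let U' : Subgroup (inertia F) := U.subgroupOf (inertia F)
  have hU'o : IsOpen (U' : Set (inertia F)) := hUo.preimage continuous_subtype_val
  haveI : Finite (inertia F ⧸ U') := Subgroup.quotient_finite_of_isOpen U' hU'o
  obtain ⟨k, hk, -, hgk⟩ := Subgroup.exists_pow_mem_of_index_ne_zero U'.index_ne_zero_of_finite g
  refine ⟨t, g ^ k, (Subgroup.mem_subgroupOf).mp hgk, ?_⟩
  rw [map_pow, ht, ← ofAdd_nsmul, nsmul_eq_mul, mul_one]
  change Multiplicative.ofAdd (k : E) ≠ Multiplicative.ofAdd 0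
  exact fun h => (Nat.cast_ne_zero.mpr hk.ne') (Multiplicative.ofAdd.injective h)

/-- **In particular on the whole inertia group**: there is `t : I_F →* Multiplicative E` which is
not identically `1` — the form in which the summit-side files take the character as a hypothesis.
[cite: SerreTate1968, Appendix] [cite: SerreInventiones1972, §1.3 Prop. 2] -/
theorem exists_inertiaCharacter_ne_one_top (E : Type*) [Field E] [CharZero E] :
    ∃ t : inertia F →* Multiplicative E, ∃ u : inertia F, t u ≠ 1 := by
  obtain ⟨t, u, -, hu⟩ := exists_inertiaCharacter_ne_one (F := F) E (inertia F) (isOpen_inertia (F := F))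
  exact ⟨t, u, hu⟩

end WeilGroup

end Literature.NumberTheory.GaloisRepresentations

end
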